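import Literature.NumberTheory.EllipticCurves.FineSelmerIsotypicBoundedProofs
import Literature.NumberTheory.NumberFields.EquivariantIwasawaLemmaTotallyRamified
import Literature.NumberTheory.IwasawaTheory.EquivariantHomLayerOfAbsolute
import Literature.NumberTheory.EllipticCurves.DivisionField
import HarnessLib

/-!
# Coates–Sujatha's Conjecture A from door L6's layer-zero data over ANY number field with a prime totally ramified in
# `K_∞` — door L6 (Γ-equivariant vanishing) + the `p`-group fixed-point bridge + the isotypic bounded-multiplicity criterion
# (proved; no definition, no named fact, no `sorry`)

`Proofs`-style file (theorems only) in topic `NumberTheory/EllipticCurves` (namespace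
`Literature.NumberTheory.EllipticCurves.CoatesSujatha2005`), written by the prover seat `bsd-potss-rkm` g39 (cell `bsd-potss`; item
stmt-BirchSwinnertonDyer-19196, `--supports`; closes nothing; (A)/BSD proved for no particular curve).

THE THEOREM (`fineSelmerDual_moduleFinite_of_homTrivial_divisionField_of_totallyRamified`).  `E = W` elliptic over a number field `K`,
`p` odd, `κ` the cyclotomic `ℤ_p`-extension of `K`, some prime of `K̄` totally ramified in `K_∞/K` (`I_𝔓̄ · Gal(K̄/K_∞) = Γ_K`); (c1)
`p ∤ [K(E[p]) : K]`; (c2*)₀ every `Γ_K`-equivariant additive `Cl(𝓞_{K(E[p])}) → E[p]` is zero; (c3*) `E[p]^{D_v} = 0` for every `v ∣ p`.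
THEN statement (A) holds for `E` at `p`: the Pontryagin dual of `Sel₀(K_∞, E[p^∞])` is finitely generated over `ℤ_p`.
Proof: door L6 (`EquivariantIwasawaLemma.equivariantHom_classGroup_eq_zero_layer_compositum_tower_of_totallyRamified`, conjA-anchor g16)
makes every `Γ_K`-equivariant `Cl(𝓞_{K(E[p])K_n}) → E[p]` zero; the `p`-group fixed-point bridge
(`EquivariantHomLayerOfAbsolute.natCard_equivariantHom_layerSubgroup_eq_one_of_forall_eq_zero`, rkm g39) turns this into «the
`Gal(K̄/K_n)`-equivariant ones number `1`»; conjA-anchor g19's isotypic bounded-multiplicity criterion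
(`fineSelmerDual_moduleFinite_of_card_equivariantHom_divisionField_layer_le`, bound `C = 1`) gives (A).  COMPARED with conjA-anchor g17's
`finite_fineSelmerInfty_of_forall_equivariantHom_classGroup_eq_zero` (door L6 ⟹ (A) through a second Washington-§13.3 descent) the
hypothesis «`K` has ONE place above `p`» is gone: any number of places above `p`, each with `E[p]^{D_v} = 0`, one of them totally ramified
in `K_∞` from layer `0`.

References: [CoatesSujatha2005] §3 Thm. 3.4, Lemma 3.8; [Washington1997] §10.1 Thm. 10.4 (proof), §13.3 Lemmas 13.14–13.16;
[DeoRaySujatha2023] §3 Thm. 3.8 (c1)–(c3); [Lim2017FineSelmer] §3; [LimSujatha2018] §3.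
-/

set_option autoImplicit false

noncomputable section

open scoped Classical Pointwise NumberField
open NumberField IsDedekindDomain Field IntermediateField

namespace Literature.NumberTheory.EllipticCurves.CoatesSujatha2005

open WeierstrassCurve Literature.NumberTheory.IwasawaTheory Literature.NumberTheory.GaloisRepresentations
  Literature.NumberTheory.NumberFields Literature.NumberTheory.EllipticCurves
  Literature.NumberTheory.EllipticCurves.GreenbergSelmer Literature.NumberTheory.EllipticCurves.ZpExtension
  Literature.NumberTheory.IwasawaTheory.EquivariantHomLayerOfAbsolute

variable {K : Type} [Field K] [NumberField K] (W : WeierstrassCurve K) [W.IsElliptic] {p : ℕ} [Fact p.Prime]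

/-- **(A) from door L6's layer-zero data over any number field with a prime totally ramified in `K_∞`.**  `E = W/K`, `p` odd,
`κ` the cyclotomic `ℤ_p`-extension with `I_𝔓̄ · Gal(K̄/K_∞) = Γ_K` for some prime `𝔓̄` of `K̄`; (c1) `p ∤ #Gal(K(E[p])/K)`; (c2*)₀ every
`Γ_K`-equivariant additive `Cl(𝓞_{K(E[p])}) → E[p]` is zero; (c3*) no non-zero point of `E[p]` is fixed by a decomposition group above `p`.
Then the Pontryagin dual of `Sel₀(E/K_∞)[p^∞]` is finitely generated over `ℤ_p` (`∃ γ D, Module.Finite ℤ_[p] D.X`).  No «one place above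
`p`» hypothesis. [cite: CoatesSujatha2005, §3 Thm. 3.4 and Lemma 3.8] [cite: Washington1997, §13.3 Lemmas 13.14–13.16 and §10.1 Thm. 10.4 (proof)]
[cite: DeoRaySujatha2023, §3 Thm. 3.8 hypotheses (c1)–(c3) (arXiv:2202.09937 p. 9)] -/
theorem fineSelmerDual_moduleFinite_of_homTrivial_divisionField_of_totallyRamified (hp : p ≠ 2)
    (κ : ZpExtension K p) (hκ : κ.IsCyclotomic)
    (hram : ∃ 𝔓' : Ideal (absIntegers (𝓞 K) K), 𝔓'.IsMaximal ∧
      𝔓'.inertia (absoluteGaloisGroup K) ⊔ κ.kerSubgroup = ⊤)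
    (hG : haveI : NeZero p := ⟨(Fact.out : p.Prime).ne_zero⟩
      ¬ p ∣ Nat.card ((W.divisionField p) ≃ₐ[K] (W.divisionField p)))
    (h0 : haveI : NeZero p := ⟨(Fact.out : p.Prime).ne_zero⟩
      ∀ μ : Additive (ClassGroup (𝓞 (W.divisionField p))) →+ W.geomTorsion (p : ℤ),
        (∀ (τ : absoluteGaloisGroup K) (c : ClassGroup (𝓞 (W.divisionField p))),
          μ (Additive.ofMul (ClassGroup.mulEquiv
            (AmbiguousClass.intAut (absRestrictNormalHom (W.divisionField p) τ)) c)) = τ • μ (Additive.ofMul c)) →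
        μ = 0)
    (hD : ∀ v : HeightOneSpectrum (𝓞 K), ((p : ℕ) : 𝓞 K) ∈ v.asIdeal →
      ∀ x : W.geomTorsion (p : ℤ), (∀ d ∈ GreenbergSelmer.decomp v, d • x = x) → x = 0) :
    ∃ (γ : absoluteGaloisGroup K) (D : W.FineSelmerDualData κ γ),
      Module.Finite ℤ_[p] (RestrictScalars ℤ_[p] (IwasawaAlgebra p) D.X) := by
  have hpr : p.Prime := Fact.out
  haveI : NeZero p := ⟨hpr.ne_zero⟩
  haveI : Finite (W.geomTorsion (p : ℤ)) := W.finite_geomTorsion_nat (NeZero.ne p)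
  have hpV : ∀ m : ↥(W.geomTorsion (p : ℤ)), p • m = 0 := fun m =>
    Subtype.ext (by
      rw [AddSubmonoidClass.coe_nsmul, ZeroMemClass.coe_zero]
      exact AddSubgroup.torsionBy.nsmul_iff.mp m.2)
  haveI hgal := fun m => κ.isGalois_layer_holds m
  haveI hfd := fun m => κ.finiteDimensional_layer_holds m
  haveI hNF : ∀ m, NumberField ↥(W.divisionField p ⊔ κ.layer m) := fun m => NumberField.of_module_finite K _
  have hL₀ : ¬ p ∣ Module.finrank K (W.divisionField p) := by rwa [← IsGalois.card_aut_eq_finrank]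
  have hV : ∀ τ : absoluteGaloisGroup K, absRestrictNormalHom (W.divisionField p) τ = 1 →
      ∀ v : W.geomTorsion (p : ℤ), τ • v = v := fun τ hτ v =>
    (W.absRestrictNormalHom_divisionField_eq_one_iff p τ).mp hτ v
  refine fineSelmerDual_moduleFinite_of_card_equivariantHom_divisionField_layer_le W hp κ hκ 1 fun n => ?_
  -- door L6 at layer `n`, then the `p`-group bridge
  have hL6 : ∀ f : Additive (ClassGroup (𝓞 ↥(W.divisionField p ⊔ κ.layer n))) →+ W.geomTorsion (p : ℤ),
      (∀ (τ : absoluteGaloisGroup K) (c : ClassGroup (𝓞 ↥(W.divisionField p ⊔ κ.layer n))),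
        f (Additive.ofMul (ClassGroup.mulEquiv (AmbiguousClass.intAut
          (absRestrictNormalHom (W.divisionField p ⊔ κ.layer n) τ)) c)) = τ • f (Additive.ofMul c)) → f = 0 :=
    fun f hf =>
    EquivariantIwasawaLemma.equivariantHom_classGroup_eq_zero_layer_compositum_tower_of_totallyRamified hp κ
      (W.divisionField p) hL₀ hram hpV hV h0 hD n f hf
  exact (natCard_equivariantHom_layerSubgroup_eq_one_of_forall_eq_zero κ _ hpV hL6 n).le

end Literature.NumberTheory.EllipticCurves.CoatesSujatha2005

end
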